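/-
Copyright (c) 2026. All rights reserved.
Released under Apache 2.0 license as described in the file LICENSE.
Authors: abc-iut cell — seat abc-iut-L6-t15 (gen 3): proof-only companion to `HolomorphicCores`
([AbsTopIII] Prop 2.5), no new definitions.
-/
import Literature.AnabelianGeometry.AbsoluteAnabelian.ParallelogramsPlanarCoorient

/-!
# Planar geometry behind [AbsTopIII] Prop 2.5, XI: exactly two orientations; `TwoOrientations` holds

Proof-only companion (no definitions) to `HolomorphicCores.lean`, concluding the series.  For an open
`U ⊆ ℂ`, `𝒮(U) ⊆ 𝒬 ⊆ 𝒫(U)` and `p ∈ U` (Prop 2.5 (d)): the orientation classes of frames at `p` —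
the quotient of the frames at `p` by strict co-orientation — are classified by the sign of the determinant
of the corner vectors: the sign is invariant, both signs occur, and frames of equal sign are connected
through square frames `(g, σ i g)` (square step, rotation steps, bisector).  Hence
`Orientations 𝒬 p ≃ Bool`, and the named fact `TwoOrientations` of `HolomorphicCores` HOLDS.

Refereed classical mathematics (S. Mochizuki, *Topics in absolute anabelian geometry III*, §2; kurims
pages); nothing here bears on the disputed parts of IUT.
-/

namespace Literature.AnabelianGeometry.AbsoluteAnabelian

open _root_.Complex _root_.Set _root_.Topology _root_.Filter _root_.Metric

noncomputable section

/-- The far end of an edge `[p, p + e]` (`e ≠ 0`) is determined by the edge.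
(Auxiliary.) [cite: MochizukiAbsTopIII2015, Proposition 2.5 (proof) pp.55–57] -/
theorem eq_of_segment_eq_segment {p e v : ℂ} (he : e ≠ 0)
    (h : segment ℝ p (p + v) = segment ℝ p (p + e)) : v = e := by
  have hpe : p ≠ p + e := by simpa using he
  rcases segment_ends_unique hpe h.symm with ⟨-, h2⟩ | ⟨h1, -⟩
  · simpa using h2
  · exact absurd h1 hpe

/-- `‖σ i g‖ = ‖g‖` for `σ = ±1`. (Auxiliary.) [cite: MochizukiAbsTopIII2015, Proposition 2.5 (proof) pp.55–57] -/
theorem norm_sigma_I_mul (g : ℂ) {σ : ℝ} (hσ : σ = 1 ∨ σ = -1) : ‖(σ : ℂ) * I * g‖ = ‖g‖ := by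
  rcases hσ with rfl | rfl <;> simp

/-- Rescaling a non-zero vector to a prescribed norm. (Auxiliary.) [cite: MochizukiAbsTopIII2015, Proposition 2.5 (proof) pp.55–57] -/
theorem norm_rescale {g : ℂ} (hg : g ≠ 0) {ρ : ℝ} (hρ : 0 < ρ) :
    ‖(((ρ / ‖g‖ : ℝ)) : ℂ) * g‖ = ρ := by
  have : 0 < ‖g‖ := norm_pos_iff.2 hg
  rw [norm_mul, Complex.norm_real, Real.norm_of_nonneg (by positivity), div_mul_cancel₀ _ this.ne']

/-- Coordinates of `g` in the basis `(f, σ i f)`. (Auxiliary.) [cite: MochizukiAbsTopIII2015, Proposition 2.5 (proof) pp.55–57] -/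
theorem eq_coords_sigma {f : ℂ} (hf : f ≠ 0) {σ : ℝ} (hσ : σ = 1 ∨ σ = -1) (g : ℂ) :
    g = ((g / f).re : ℂ) * f + ((σ * (g / f).im : ℝ) : ℂ) * ((σ : ℂ) * I * f) := by
  have hσ2 : (σ : ℂ) * σ = 1 := by rcases hσ with rfl | rfl <;> norm_num
  have h := eq_re_mul_add_im_mul hf g
  conv_lhs => rw [h]
  push_cast
  linear_combination -((g / f).im : ℂ) * I * f * hσ2

/-- **Prop 2.5 (d)/(e)**: at every point `p` of an open `U ⊆ ℂ`, for any `𝒮(U) ⊆ 𝒬 ⊆ 𝒫(U)`, there are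
EXACTLY TWO orientations: the quotient `Orientations 𝒬 p` of the frames at `p` by strict co-orientation is
in bijection with `Bool` (via the sign of the determinant of the corner vectors).
[cite: MochizukiAbsTopIII2015, Proposition 2.5 (d) p.56] -/
theorem Parallelograms.nonempty_orientations_equiv_bool {U : Set ℂ} (hU : IsOpen U) {𝒬 : Set (Set U)}
    (h𝒬 : ∀ Q ∈ 𝒬, Subtype.val '' Q ∈ parallelogramsIn U)
    (h𝒮 : ∀ Q : Set U, Subtype.val '' Q ∈ squaresIn U → Q ∈ 𝒬) (p : U) :
    Nonempty (Parallelograms.Orientations 𝒬 p ≃ Bool) := by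
  classical
  -- an admissibility radius
  obtain ⟨r₀, hr₀, hball⟩ := Metric.isOpen_iff.1 hU p p.2
  set ρ : ℝ := r₀ / 3 with hρ
  have hρpos : 0 < ρ := by positivity
  have hadm : ∀ e₁ e₂ : ℂ, ‖e₁‖ ≤ ρ → ‖e₂‖ ≤ ρ → closure (openParallelogram (p : ℂ) e₁ e₂) ⊆ U := by
    intro e₁ e₂ h1 h2 x hx
    have := closure_openParallelogram_subset_closedBall (p : ℂ) e₁ e₂ hx
    apply hball
    rw [mem_closedBall] at this
    rw [Metric.mem_ball]
    linarith
  -- frames at `p`, the relation, frames from corner vectors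
  unfold Parallelograms.Orientations
  set T := {PF : Set U × (Set U × Set U) // Parallelograms.IsFrameOf 𝒬 p PF.1 PF.2} with hT
  set rel : T → T → Prop := fun F F' => Parallelograms.StrictlyCoOriented 𝒬 F.1.1 F.1.2 F'.1.1 F'.1.2
    with hrel
  let FrV : ∀ (e₁ e₂ : ℂ), LinearIndependent ℝ ![e₁, e₂] → closure (openParallelogram (p : ℂ) e₁ e₂) ⊆ U → T :=
    fun e₁ e₂ he hcl => ⟨(Subtype.val ⁻¹' openParallelogram (p : ℂ) e₁ e₂,
      (Subtype.val ⁻¹' segment ℝ (p : ℂ) (p + e₁), Subtype.val ⁻¹' segment ℝ (p : ℂ) (p + e₂))),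
      Parallelograms.isFrameOf_of_vectors hU h𝒬 h𝒮 he hcl⟩
  -- one step
  have Q1 : ∀ {e₁ e₂ f₁ f₂ : ℂ} (he : LinearIndependent ℝ ![e₁, e₂]) (hf : LinearIndependent ℝ ![f₁, f₂])
      (hce : closure (openParallelogram (p : ℂ) e₁ e₂) ⊆ U)
      (hcf : closure (openParallelogram (p : ℂ) f₁ f₂) ⊆ U) {α β γ δ : ℝ}, 0 < α → 0 < β → 0 < γ → 0 < δ →
      f₁ = (α : ℂ) * e₁ + (β : ℂ) * e₂ → e₂ = (γ : ℂ) * f₁ + (δ : ℂ) * f₂ →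
      Quot.mk rel (FrV e₁ e₂ he hce) = Quot.mk rel (FrV f₁ f₂ hf hcf) := by
    intro e₁ e₂ f₁ f₂ he hf hce hcf α β γ δ hα hβ hγ hδ h1 h2
    exact Quot.sound (Parallelograms.strictlyCoOriented_of_pos_coeffs hU h𝒬 h𝒮 he hf hce hcf hα hβ hγ hδ h1 h2)
  -- square frames `(g, σ i g)`
  have hsqadm : ∀ {σ : ℝ} (hσ : σ = 1 ∨ σ = -1) (g : ℂ), ‖g‖ ≤ ρ →
      closure (openParallelogram (p : ℂ) g ((σ : ℂ) * I * g)) ⊆ U := fun hσ g hgρ =>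
    hadm _ _ hgρ (by rw [norm_sigma_I_mul g hσ]; exact hgρ)
  let SqT : ∀ (σ : ℝ) (hσ : σ = 1 ∨ σ = -1) (g : ℂ), g ≠ 0 → ‖g‖ ≤ ρ → T := fun σ hσ g hg hgρ =>
    FrV g ((σ : ℂ) * I * g) (linearIndependent_pair_sigma_I hg hσ) (hsqadm hσ g hgρ)
  -- a combination with a positive coefficient on `f` of the independent pair `(f, σ i f)` is non-zero
  have hne_comb : ∀ {f : ℂ} (hf : f ≠ 0) {σ : ℝ} (hσ : σ = 1 ∨ σ = -1) {s t : ℝ}, 0 < s ∨ 0 < t →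
      (s : ℂ) * f + (t : ℂ) * ((σ : ℂ) * I * f) ≠ 0 := by
    intro f hf σ hσ s t hst h0
    have := (LinearIndependent.pair_iff.1 (linearIndependent_pair_sigma_I hf hσ)) s t (by
      rw [Complex.real_smul, Complex.real_smul, h0])
    rcases hst with h | h
    · linarith [this.1]
    · linarith [this.2]
  -- Q2: rotation step between square frames
  have Q2 : ∀ {σ : ℝ} (hσ : σ = 1 ∨ σ = -1) {f g : ℂ} (hf : f ≠ 0) (hfρ : ‖f‖ ≤ ρ) (hg : g ≠ 0)
      (hgρ : ‖g‖ ≤ ρ) {a b : ℝ}, 0 < a → 0 < b → g = (a : ℂ) * f + (b : ℂ) * ((σ : ℂ) * I * f) →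
      Quot.mk rel (SqT σ hσ f hf hfρ) = Quot.mk rel (SqT σ hσ g hg hgρ) := by
    intro σ hσ f g hf hfρ hg hgρ a b ha hb hgeq
    obtain ⟨γ, δ, hγ, hδ, h2⟩ := rotation_step hσ ha hb hgeq
    exact Q1 (linearIndependent_pair_sigma_I hf hσ) (linearIndependent_pair_sigma_I hg hσ)
      (hsqadm hσ f hfρ) (hsqadm hσ g hgρ) ha hb hγ hδ hgeq h2
  -- Q3: two rotation steps through the bisector
  have Q3 : ∀ {σ : ℝ} (hσ : σ = 1 ∨ σ = -1) {f g : ℂ} (hf : f ≠ 0) (hfρ : ‖f‖ ≤ ρ) (hg : g ≠ 0)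
      (hgρ : ‖g‖ ≤ ρ) {u v : ℝ}, 0 < v → g = (u : ℂ) * f + (v : ℂ) * ((σ : ℂ) * I * f) →
      Quot.mk rel (SqT σ hσ f hf hfρ) = Quot.mk rel (SqT σ hσ g hg hgρ) := by
    intro σ hσ f g hf hfρ hg hgρ u v hv hgeq
    obtain ⟨s, t, h, hs, ht, hh, a', b', ha', hb', hg'⟩ := bisector_step hσ hv hgeq
    have hh0 : h ≠ 0 := by rw [hh]; exact hne_comb hf hσ (Or.inl hs)
    have hhn : 0 < ‖h‖ := norm_pos_iff.2 hh0
    set lam : ℝ := ρ / ‖h‖ with hlam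
    have hlam0 : 0 < lam := by positivity
    have hlamC : (lam : ℂ) ≠ 0 := by exact_mod_cast hlam0.ne'
    set h' : ℂ := (lam : ℂ) * h with hh'
    have hh'0 : h' ≠ 0 := mul_ne_zero hlamC hh0
    have hh'ρ : ‖h'‖ ≤ ρ := (norm_rescale hh0 hρpos).le
    have e1 : h' = ((lam * s : ℝ) : ℂ) * f + ((lam * t : ℝ) : ℂ) * ((σ : ℂ) * I * f) := by
      rw [hh', hh]; push_cast; ring
    have e2 : g = ((a' / lam : ℝ) : ℂ) * h' + ((b' / lam : ℝ) : ℂ) * ((σ : ℂ) * I * h') := by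
      rw [hg', hh']; push_cast; field_simp
    exact (Q2 hσ hf hfρ hh'0 hh'ρ (by positivity) (by positivity) e1).trans
      (Q2 hσ hh'0 hh'ρ hg hgρ (by positivity) (by positivity) e2)
  -- Q4: any two square frames of the same sign are connected
  have Q4 : ∀ {σ : ℝ} (hσ : σ = 1 ∨ σ = -1) {f g : ℂ} (hf : f ≠ 0) (hfρ : ‖f‖ ≤ ρ) (hg : g ≠ 0)
      (hgρ : ‖g‖ ≤ ρ), Quot.mk rel (SqT σ hσ f hf hfρ) = Quot.mk rel (SqT σ hσ g hg hgρ) := by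
    intro σ hσ f g hf hfρ hg hgρ
    have hσ2 : σ * σ = 1 := by rcases hσ with rfl | rfl <;> norm_num
    have hco := eq_coords_sigma hf hσ g
    set u : ℝ := (g / f).re with hu
    set v : ℝ := σ * (g / f).im with hv
    rcases lt_trichotomy 0 v with hv0 | hv0 | hv0
    · exact Q3 hσ hf hfρ hg hgρ hv0 hco
    · -- `g = u f` with `u ≠ 0`
      have hgu : g = (u : ℂ) * f := by rw [hco, ← hv0]; push_cast; ring
      have hu0 : u ≠ 0 := by rintro h0; rw [h0] at hgu; simp at hgu; exact hg hgu
      rcases lt_or_gt_of_ne hu0 with hu0 | hu0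
      · -- u < 0: go through `k = λ σ i f`
        set k₀ : ℂ := (σ : ℂ) * I * f with hk₀
        have hk₀0 : k₀ ≠ 0 := by
          rw [hk₀]; refine mul_ne_zero (mul_ne_zero ?_ Complex.I_ne_zero) hf
          rcases hσ with rfl | rfl <;> norm_num
        set lam : ℝ := ρ / ‖k₀‖ with hlam
        have hlam0 : 0 < lam := by have := norm_pos_iff.2 hk₀0; positivity
        have hlamC : (lam : ℂ) ≠ 0 := by exact_mod_cast hlam0.ne'
        set k : ℂ := (lam : ℂ) * k₀ with hk
        have hk0 : k ≠ 0 := mul_ne_zero hlamC hk₀0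
        have hkρ : ‖k‖ ≤ ρ := (norm_rescale hk₀0 hρpos).le
        have e1 : k = ((0 : ℝ) : ℂ) * f + (lam : ℂ) * ((σ : ℂ) * I * f) := by rw [hk, hk₀]; push_cast; ring
        have e2 : g = ((0 : ℝ) : ℂ) * k + ((-u / lam : ℝ) : ℂ) * ((σ : ℂ) * I * k) := by
          rw [hgu, hk, hk₀]
          have hlam0' : lam ≠ 0 := hlam0.ne'
          rcases hσ with rfl | rfl <;> apply Complex.ext <;>
            simp only [Complex.mul_re, Complex.mul_im, Complex.add_re, Complex.add_im, Complex.ofReal_re,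
              Complex.ofReal_im, Complex.I_re, Complex.I_im] <;>
            field_simp <;> ring
        exact (Q3 hσ hf hfρ hk0 hkρ hlam0 e1).trans (Q3 hσ hk0 hkρ hg hgρ (by
          exact div_pos (by linarith) hlam0) e2)
      · -- u > 0: both reach `k = λ (f + σ i f)`
        set k₀ : ℂ := f + (σ : ℂ) * I * f with hk₀
        have hk₀0 : k₀ ≠ 0 := by
          have := hne_comb hf hσ (s := 1) (t := 1) (Or.inl one_pos)
          simpa [hk₀] using this
        set lam : ℝ := ρ / ‖k₀‖ with hlam
        have hlam0 : 0 < lam := by have := norm_pos_iff.2 hk₀0; positivity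
        have hlamC : (lam : ℂ) ≠ 0 := by exact_mod_cast hlam0.ne'
        set k : ℂ := (lam : ℂ) * k₀ with hk
        have hk0 : k ≠ 0 := mul_ne_zero hlamC hk₀0
        have hkρ : ‖k‖ ≤ ρ := (norm_rescale hk₀0 hρpos).le
        have e1 : k = (lam : ℂ) * f + (lam : ℂ) * ((σ : ℂ) * I * f) := by rw [hk, hk₀]; ring
        have huC : (u : ℂ) ≠ 0 := by exact_mod_cast hu0.ne'
        have e2 : k = ((lam / u : ℝ) : ℂ) * g + ((lam / u : ℝ) : ℂ) * ((σ : ℂ) * I * g) := by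
          rw [hgu, hk, hk₀]; push_cast; field_simp
        exact (Q2 hσ hf hfρ hk0 hkρ hlam0 hlam0 e1).trans
          (Q2 hσ hg hgρ hk0 hkρ (by positivity) (by positivity) e2).symm
    · -- v < 0: swap the roles of `f` and `g`
      have hco' := eq_coords_sigma hg hσ f
      have hgf : g / f ≠ 0 := div_ne_zero hg hf
      have hfg : f / g = (g / f)⁻¹ := by rw [inv_div]
      have hv' : 0 < σ * (f / g).im := by
        rw [hfg, Complex.inv_im]
        have hn : 0 < Complex.normSq (g / f) := Complex.normSq_pos.2 hgf
        have : σ * (-(g / f).im / Complex.normSq (g / f)) = (-v) / Complex.normSq (g / f) := by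
          rw [hv]; ring
        rw [this]
        exact div_pos (by linarith) hn
      exact (Q3 hσ hg hgρ hf hfρ hv' hco').symm
  -- the corner vectors of a frame, and of a frame built from vectors
  have hvec : ∀ F : T, ∃ v : ℂ × ℂ, LinearIndependent ℝ ![v.1, v.2] ∧
      Subtype.val '' F.1.1 = openParallelogram (p : ℂ) v.1 v.2 ∧
      closure (openParallelogram (p : ℂ) v.1 v.2) ⊆ U ∧
      Subtype.val '' F.1.2.1 = segment ℝ (p : ℂ) (p + v.1) ∧
      Subtype.val '' F.1.2.2 = segment ℝ (p : ℂ) (p + v.2) := fun F => by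
    obtain ⟨e₁, e₂, h⟩ := Parallelograms.IsFrameOf.exists_vectors hU h𝒬 h𝒮 F.2
    exact ⟨(e₁, e₂), h⟩
  choose vec hvec using hvec
  have himg : ∀ {S : Set ℂ}, S ⊆ U → Subtype.val '' (Subtype.val ⁻¹' S : Set U) = S := fun hS => by
    rw [image_preimage_eq_inter_range, Subtype.range_coe, inter_eq_left.2 hS]
  have hsegU : ∀ {e₁ e₂ : ℂ} (he : LinearIndependent ℝ ![e₁, e₂])
      (hcl : closure (openParallelogram (p : ℂ) e₁ e₂) ⊆ U),
      segment ℝ (p : ℂ) (p + e₁) ⊆ U ∧ segment ℝ (p : ℂ) (p + e₂) ⊆ U := by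
    intro e₁ e₂ he hcl
    have hm := fun s t (hs : (0:ℝ) ≤ s) (hs1 : s ≤ 1) (ht : (0:ℝ) ≤ t) (ht1 : t ≤ 1) =>
      (mem_closure_openParallelogram_iff he (x := (p : ℂ) + (s : ℂ) * e₁ + (t : ℂ) * e₂)).2
        ⟨s, t, hs, hs1, ht, ht1, rfl⟩
    have hK := convex_closure_openParallelogram (p : ℂ) e₁ e₂
    have h0 : (p : ℂ) ∈ closure (openParallelogram (p : ℂ) e₁ e₂) := by
      simpa using hm 0 0 le_rfl zero_le_one le_rfl zero_le_one
    exact ⟨(hK.segment_subset h0 (by simpa using hm 1 0 zero_le_one le_rfl le_rfl zero_le_one)).trans hcl,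
      (hK.segment_subset h0 (by simpa using hm 0 1 le_rfl zero_le_one zero_le_one le_rfl)).trans hcl⟩
  have VEC : ∀ (e₁ e₂ : ℂ) (he : LinearIndependent ℝ ![e₁, e₂])
      (hcl : closure (openParallelogram (p : ℂ) e₁ e₂) ⊆ U), vec (FrV e₁ e₂ he hcl) = (e₁, e₂) := by
    intro e₁ e₂ he hcl
    have h := hvec (FrV e₁ e₂ he hcl)
    obtain ⟨hS₁, hS₂⟩ := hsegU he hcl
    have h1 : Subtype.val '' (FrV e₁ e₂ he hcl).1.2.1 = segment ℝ (p : ℂ) (p + e₁) := himg hS₁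
    have h2 : Subtype.val '' (FrV e₁ e₂ he hcl).1.2.2 = segment ℝ (p : ℂ) (p + e₂) := himg hS₂
    refine Prod.ext ?_ ?_
    · exact eq_of_segment_eq_segment (by simpa using he.ne_zero 0) (h.2.2.2.1.symm.trans h1)
    · exact eq_of_segment_eq_segment (by simpa using he.ne_zero 1) (h.2.2.2.2.symm.trans h2)
  -- every frame is the frame of its corner vectors
  have hFrV : ∀ F : T, F = FrV (vec F).1 (vec F).2 (hvec F).1 (hvec F).2.2.1 := by
    intro F
    have h := hvec F
    apply Subtype.ext
    refine Prod.ext ?_ (Prod.ext ?_ ?_)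
    · exact (eq_preimage_image_val _).trans (congrArg (fun S : Set ℂ => (Subtype.val ⁻¹' S : Set U)) h.2.1)
    · exact (eq_preimage_image_val _).trans
        (congrArg (fun S : Set ℂ => (Subtype.val ⁻¹' S : Set U)) h.2.2.2.1)
    · exact (eq_preimage_image_val _).trans
        (congrArg (fun S : Set ℂ => (Subtype.val ⁻¹' S : Set U)) h.2.2.2.2)
  -- Q5: every frame reaches a square frame of its sign
  have Q5 : ∀ (F : T) (σ : ℝ) (hσ : σ = 1 ∨ σ = -1),
      0 < σ * ((vec F).1.re * (vec F).2.im - (vec F).1.im * (vec F).2.re) →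
      ∃ (g : ℂ) (hg : g ≠ 0) (hgρ : ‖g‖ ≤ ρ), Quot.mk rel F = Quot.mk rel (SqT σ hσ g hg hgρ) := by
    intro F σ hσ hsgn
    have hF := hvec F
    obtain ⟨g, hg0, a, b, γ, δ, ha, hb, hγ, hδ, h1, h2⟩ := exists_square_step hF.1 hσ hsgn
    set lam : ℝ := ρ / ‖g‖ with hlam
    have hlam0 : 0 < lam := by have := norm_pos_iff.2 hg0; positivity
    have hlamC : (lam : ℂ) ≠ 0 := by exact_mod_cast hlam0.ne'
    set g' : ℂ := (lam : ℂ) * g with hg'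
    have hg'0 : g' ≠ 0 := mul_ne_zero hlamC hg0
    have hg'ρ : ‖g'‖ ≤ ρ := (norm_rescale hg0 hρpos).le
    have e1 : g' = ((lam * a : ℝ) : ℂ) * (vec F).1 + ((lam * b : ℝ) : ℂ) * (vec F).2 := by
      rw [hg', h1]; push_cast; ring
    have e2 : (vec F).2 = ((γ / lam : ℝ) : ℂ) * g' + ((δ / lam : ℝ) : ℂ) * ((σ : ℂ) * I * g') := by
      rw [hg']; conv_lhs => rw [h2]
      push_cast; field_simp
    refine ⟨g', hg'0, hg'ρ, ?_⟩
    rw [hFrV F]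
    exact Q1 (hvec F).1 (linearIndependent_pair_sigma_I hg'0 hσ) (hvec F).2.2.1 (hsqadm hσ g' hg'ρ)
      (by positivity) (by positivity) (by positivity) (by positivity) e1 e2
  -- the determinant sign and the map to `Bool`
  have hwd : ∀ F F' : T, rel F F' →
      (0 < (vec F).1.re * (vec F).2.im - (vec F).1.im * (vec F).2.re ↔
        0 < (vec F').1.re * (vec F').2.im - (vec F').1.im * (vec F').2.re) := fun F F' h =>
    Parallelograms.StrictlyCoOriented.det_pos_iff h (hvec F).1 (hvec F').1 (hvec F).2.1
      (hvec F).2.2.2.2 (hvec F').2.1 (hvec F').2.2.2.1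
  let Φ : Quot rel → Bool := Quot.lift
    (fun F => decide (0 < (vec F).1.re * (vec F).2.im - (vec F).1.im * (vec F).2.re))
    (fun F F' h => by rw [decide_eq_decide]; exact hwd F F' h)
  refine ⟨Equiv.ofBijective Φ ⟨?_, ?_⟩⟩
  · -- injective
    intro x y
    induction x using Quot.ind with | _ F => ?_
    induction y using Quot.ind with | _ F' => ?_
    intro hxy
    change decide _ = decide _ at hxy
    rw [decide_eq_decide] at hxy
    have hdF : (vec F).1.re * (vec F).2.im - (vec F).1.im * (vec F).2.re ≠ 0 :=
      (linearIndependent_pair_iff_det _ _).1 (hvec F).1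
    -- the common sign
    obtain ⟨σ, hσ, hsF, hsF'⟩ : ∃ σ : ℝ, (σ = 1 ∨ σ = -1) ∧
        0 < σ * ((vec F).1.re * (vec F).2.im - (vec F).1.im * (vec F).2.re) ∧
        0 < σ * ((vec F').1.re * (vec F').2.im - (vec F').1.im * (vec F').2.re) := by
      by_cases hpos : 0 < (vec F).1.re * (vec F).2.im - (vec F).1.im * (vec F).2.re
      · exact ⟨1, Or.inl rfl, by linarith, by linarith [hxy.1 hpos]⟩
      · have hdF' : (vec F').1.re * (vec F').2.im - (vec F').1.im * (vec F').2.re ≠ 0 :=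
          (linearIndependent_pair_iff_det _ _).1 (hvec F').1
        have h1 : (vec F).1.re * (vec F).2.im - (vec F).1.im * (vec F).2.re < 0 :=
          lt_of_le_of_ne (not_lt.1 hpos) hdF
        have h2 : (vec F').1.re * (vec F').2.im - (vec F').1.im * (vec F').2.re < 0 :=
          lt_of_le_of_ne (not_lt.1 fun h => hpos (hxy.2 h)) hdF'
        exact ⟨-1, Or.inr rfl, by linarith, by linarith⟩
    obtain ⟨g, hg, hgρ, hFg⟩ := Q5 F σ hσ hsF
    obtain ⟨g', hg', hg'ρ, hF'g'⟩ := Q5 F' σ hσ hsF'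
    exact hFg.trans ((Q4 hσ hg hgρ hg' hg'ρ).trans hF'g'.symm)
  · -- surjective: both signs occur
    have hρC : ((ρ : ℝ) : ℂ) ≠ 0 := by exact_mod_cast hρpos.ne'
    have hli : LinearIndependent ℝ ![((ρ : ℝ) : ℂ), ((1 : ℝ) : ℂ) * I * (ρ : ℝ)] :=
      linearIndependent_pair_sigma_I hρC (Or.inl rfl)
    have hli' := LinearIndependent.pair_symm_iff.mp hli
    have hn1 : ‖((ρ : ℝ) : ℂ)‖ ≤ ρ := by rw [Complex.norm_real, Real.norm_of_nonneg hρpos.le]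
    have hn2 : ‖((1 : ℝ) : ℂ) * I * (ρ : ℝ)‖ ≤ ρ := by rw [norm_sigma_I_mul _ (Or.inl rfl)]; exact hn1
    intro b
    cases b
    · refine ⟨Quot.mk rel (FrV (((1 : ℝ) : ℂ) * I * (ρ : ℝ)) ((ρ : ℝ) : ℂ) hli' (hadm _ _ hn2 hn1)), ?_⟩
      change decide _ = false
      rw [VEC _ _ hli' (hadm _ _ hn2 hn1), decide_eq_false_iff_not]
      simp only [Complex.mul_re, Complex.mul_im, Complex.ofReal_re, Complex.ofReal_im, Complex.I_re,
        Complex.I_im]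
      nlinarith
    · refine ⟨Quot.mk rel (FrV ((ρ : ℝ) : ℂ) (((1 : ℝ) : ℂ) * I * (ρ : ℝ)) hli (hadm _ _ hn1 hn2)), ?_⟩
      change decide _ = true
      rw [VEC _ _ hli (hadm _ _ hn1 hn2), decide_eq_true_iff]
      simp only [Complex.mul_re, Complex.mul_im, Complex.ofReal_re, Complex.ofReal_im, Complex.I_re,
        Complex.I_im]
      nlinarith

/-- **[AbsTopIII] Prop 2.5 — the named fact `TwoOrientations` HOLDS**: for a connected open `U ⊆ ℂ` and
`𝒬 = 𝒮(U)` the pre-compact squares, the parallelogram algorithm (a)–(c) recovers exactly `𝒫(U)`, and at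
every point of `U` there are exactly two orientations (d).  (Connectedness of `U` is not used.)
[cite: MochizukiAbsTopIII2015, Proposition 2.5 pp.55–57] -/
theorem twoOrientations_holds : TwoOrientations := by
  intro U hU _
  exact ⟨Parallelograms.parallelograms_squaresIn_eq hU, fun p =>
    Parallelograms.nonempty_orientations_equiv_bool hU (fun _ hQ => squaresIn_subset_parallelogramsIn U hQ)
      (fun _ h => h) p⟩

end

end Literature.AnabelianGeometry.AbsoluteAnabelian
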